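import Summits.QuantumFields.YangMills.Theorems.BalabanUVNodesClusters
import Literature.MathematicalPhysics.QuantumFieldTheory.Balaban1983to89.B13NodeKnitRecord5C
import Literature.MathematicalPhysics.QuantumFieldTheory.Balaban1983to89.Node00.Record8

/-!
# BalabanUVNodes ∕ N10 at the record — the route stub SHAPE `YMDAG.UVSplit.S_N10 Rec` ([Balaban1988RG2Cluster] Lemmas 1–3, `Dag.B13_main`)
# for EVERY record predicate `Rec` refining NODE 00's Stage-5 record of record `Node00.IsRecordOfRecord₅C`, from the displayed slot (B13₅)
# (Track A, DAG node N10; cluster K2 «FlowBounds»; KNIT-BY-NAME seat `pub-ymgap-dag-p2` = n10-a, text g4, filed g5)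

HONEST FRAMING.  Count-neutral kernel bookkeeping: the route module's stub signature `S_N10 Rec := AtRecord Rec Dag.B13_main`
(`BalabanUVNodesClusters`, filed by this seat as courier of the dagwriter's bytes) is CLOSED BY NAME from the Literature-side knit at the record
(`B13NodeKnitRecord5C.b13_main_forall_isRecordOfRecord₅C`, p412849) for every `Rec` that refines `IsRecordOfRecord₅C` — MODULO the displayed slot
(B13₅) «at every admissible Stage-5 parameter θ and run P, the in-edge leaves at the residual carriers imply the B13 triple of the residual B13
group» (a HYPOTHESIS: at Stage 5 the B13 group is residual FREE data; NODE 00 Stage ≥ 6 ∕ ₉ pins it — then the torus chain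
`B13NodeTorusTermwise` ∕ `B13NodeTorusFamilyLocated` supplies the triple).  NOT a discharge of N10; nothing of Bałaban's asserted; one finite
four-torus programme at fixed ε; nothing continuum ∕ ℝ⁴ ∕ OS ∕ mass-gap ∕ Clay.  0 `sorry`, 0 `def`, standard axioms.  Filed `--supports`
item `StabilityBAtRecord` (stmt-QuantumFields-19183) of route «BalabanUVNodes» (director-ym LINE №12).

THE NODE.  `Dag.B13_main ℓ := ℓ.b9 → ℓ.b10 → ℓ.b11 → ℓ.b12 → ℓ.b13` (Dag.lean :218), `b13 = B13.Lemma1Printed S c ∧ Lemma2Printed S c ∧ Lemma3Printed S c`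
([Balaban1988RG2Cluster] Lemma 1 p. 9, Lemma 2 p. 11, Lemma 3 p. 20).  At a ₅C record every leaf N10 reads is `Iff.rfl`-located at the residual
carriers `θ.res.X ∕ Y ∕ Z P` (`B13NodeKnitRecord5C.b13_main_iff_res₅C`).

WHAT THIS FILE PROVES.
* `s_N10_of_refines₅C` — `S_N10 Rec` for every `Rec : RecordPred N` with `Rec F D w → Node00.IsRecordOfRecord₅C F N D w`, from the slot (B13₅) per
  family `F`; `s_N10_rec₅C` ∕ `s_N10_rec₇C` ∕ `s_N10_rec₈C` — the instances `Rec :=` ₅C (the record of record), ₇C (`Node00.Record7`, p412134) and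
  ₈C (`Node00.Record8`, p414247; (B′) γ-clause) through the landed refinements `isRecordOfRecord₅C_of_isRecordOfRecord₇C ∕ ₈C`;
* `s_N10_of_refines₅C_twoTorus` — the same from a FAMILY OF TORUS PINS `(θ.res.X P).S13 = (Wt F θ P).toStepData`, `c13 = c F θ P` with the torus leaf
  triple per (F, θ, P) (the shape NODE 00's later stage + `B13NodeTorusTermwise.b13Leaf_twoTorus_primitives` instantiate);
* `flowBounds_N10_conjunct` — bookkeeping: the N10 conjunct of the cluster statement `FlowBounds Rec` is exactly `S_N10 Rec` (`FlowBounds_of` takes it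
  as its third argument).
-/

noncomputable section

namespace Summit.QuantumFields.YangMills.BalabanUVNodes.N10AtRecord

open Literature.MathematicalPhysics.QuantumFieldTheory.Balaban1983to89
open Literature.MathematicalPhysics.QuantumFieldTheory.Balaban1983to89.T4Continuum
open Literature.MathematicalPhysics.QuantumFieldTheory.Balaban1983to89.DagBinding
open Literature.MathematicalPhysics.QuantumFieldTheory.Balaban1983to89.Node00
  (Stage5Params IsRecordOfRecord₅C IsRecordOfRecord₇C IsRecordOfRecord₈C isRecordOfRecord₅C_of_isRecordOfRecord₇C
    isRecordOfRecord₅C_of_isRecordOfRecord₈C)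
open Literature.MathematicalPhysics.QuantumFieldTheory.Balaban1983to89.B13Lemma3Torus (TwoTorusStep)
open Literature.MathematicalPhysics.QuantumFieldTheory.Balaban1983to89.B13NodeKnitRecord5C
  (b13_main_forall_isRecordOfRecord₅C b13_main_forall_isRecordOfRecord₅C_twoTorus)
open YMDAG.UVSplit

variable {N : ℕ} [NeZero N]

/-- **`S_N10 Rec` FOR EVERY RECORD PREDICATE REFINING ₅C, from the slot (B13₅)** ([Balaban1988RG2Cluster] Lemmas 1–3 at the residual B13 group of
every admissible Stage-5 parameter and run, given the in-edge leaves at the residual carriers).  `Rec` refining `IsRecordOfRecord₅C` covers ₅C itself,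
₇C ∕ ₈C (`Node00.isRecordOfRecord₅C_of_isRecordOfRecord₇C` …) and the ₉C re-base once its refinement to ₅C is proved (node00-def STAGE6-9-DESIGN §2). -/
theorem s_N10_of_refines₅C (Rec : RecordPred N)
    (href : ∀ (F : T4Family) (D : Datum F N) (w : WorldP), Rec F D w → IsRecordOfRecord₅C F N D w)
    (slots : ∀ (F : T4Family) (θ : Stage5Params F N), θ.Admissible → ∀ P : B12.RunParams,
      B9LeafX (θ.res.Y P) →
        (B10.Thm1PrintedCompact (θ.res.X P).runs10 ∧ B10.Thm2Printed (θ.res.X P).runs10) →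
          B11Leaf (θ.res.Z P) → B12Sec2to5.Lemma4Printed (θ.res.X P).F12 (θ.res.X P).c12 →
            B13.Lemma1Printed (θ.res.X P).S13 (θ.res.X P).c13 ∧ B13.Lemma2Printed (θ.res.X P).S13 (θ.res.X P).c13 ∧
              B13.Lemma3Printed (θ.res.X P).S13 (θ.res.X P).c13) :
    S_N10 Rec :=
  fun F D w hR P => b13_main_forall_isRecordOfRecord₅C (slots F) D w (href F D w hR) P

/-- **`S_N10` AT THE RECORD PREDICATE OF RECORD ITSELF** (`Rec := IsRecordOfRecord₅C`), from the slot (B13₅). [cite: Balaban1988RG2Cluster, Lemmas 1–3 pp.9, 11, 20] -/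
theorem s_N10_rec₅C
    (slots : ∀ (F : T4Family) (θ : Stage5Params F N), θ.Admissible → ∀ P : B12.RunParams,
      B9LeafX (θ.res.Y P) →
        (B10.Thm1PrintedCompact (θ.res.X P).runs10 ∧ B10.Thm2Printed (θ.res.X P).runs10) →
          B11Leaf (θ.res.Z P) → B12Sec2to5.Lemma4Printed (θ.res.X P).F12 (θ.res.X P).c12 →
            B13.Lemma1Printed (θ.res.X P).S13 (θ.res.X P).c13 ∧ B13.Lemma2Printed (θ.res.X P).S13 (θ.res.X P).c13 ∧
              B13.Lemma3Printed (θ.res.X P).S13 (θ.res.X P).c13) :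
    S_N10 (fun F D w => IsRecordOfRecord₅C F N D w) :=
  s_N10_of_refines₅C _ (fun _ _ _ h => h) slots

/-- **`S_N10` AT THE STAGE-7 RECORD** (`Rec := IsRecordOfRecord₇C`, the ROp∕χ objects of record pinned; refines ₅C by
`Node00.isRecordOfRecord₅C_of_isRecordOfRecord₇C`), from the slot (B13₅). [cite: Balaban1988RG2Cluster, Lemmas 1–3 pp.9, 11, 20] -/
theorem s_N10_rec₇C
    (slots : ∀ (F : T4Family) (θ : Stage5Params F N), θ.Admissible → ∀ P : B12.RunParams,
      B9LeafX (θ.res.Y P) →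
        (B10.Thm1PrintedCompact (θ.res.X P).runs10 ∧ B10.Thm2Printed (θ.res.X P).runs10) →
          B11Leaf (θ.res.Z P) → B12Sec2to5.Lemma4Printed (θ.res.X P).F12 (θ.res.X P).c12 →
            B13.Lemma1Printed (θ.res.X P).S13 (θ.res.X P).c13 ∧ B13.Lemma2Printed (θ.res.X P).S13 (θ.res.X P).c13 ∧
              B13.Lemma3Printed (θ.res.X P).S13 (θ.res.X P).c13) :
    S_N10 (fun F D w => IsRecordOfRecord₇C F N D w) :=
  s_N10_of_refines₅C _ (fun _ _ _ h => isRecordOfRecord₅C_of_isRecordOfRecord₇C h) slots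

/-- **`S_N10` AT THE STAGE-8 RECORD** (`Rec := IsRecordOfRecord₈C`, β of record + actions pinned, (B′) γ-clause; refines ₅C by
`Node00.isRecordOfRecord₅C_of_isRecordOfRecord₈C`), from the slot (B13₅) — the predicate n24-a ∕ n26-a ∕ n28-a type their ₈C modules over.
∀-FORM over every ₈C record (hygiene R445 (A)): the B13 leaf reads no β-layer ∕ chart of the Stage-8 parameter, so the zero-chart rider
(«ZEROCHART v0.33») does not bear on this statement; the slot itself is the ∀-over-admissible-θ form at Stage 5. [cite: Balaban1988RG2Cluster, Lemmas 1–3 pp.9, 11, 20] -/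
theorem s_N10_rec₈C
    (slots : ∀ (F : T4Family) (θ : Stage5Params F N), θ.Admissible → ∀ P : B12.RunParams,
      B9LeafX (θ.res.Y P) →
        (B10.Thm1PrintedCompact (θ.res.X P).runs10 ∧ B10.Thm2Printed (θ.res.X P).runs10) →
          B11Leaf (θ.res.Z P) → B12Sec2to5.Lemma4Printed (θ.res.X P).F12 (θ.res.X P).c12 →
            B13.Lemma1Printed (θ.res.X P).S13 (θ.res.X P).c13 ∧ B13.Lemma2Printed (θ.res.X P).S13 (θ.res.X P).c13 ∧
              B13.Lemma3Printed (θ.res.X P).S13 (θ.res.X P).c13) :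
    S_N10 (fun F D w => IsRecordOfRecord₈C F N D w) :=
  s_N10_of_refines₅C _ (fun _ _ _ h => isRecordOfRecord₅C_of_isRecordOfRecord₈C h) slots

/-- **`S_N10 Rec` FROM A FAMILY OF TORUS PINS** (every `Rec` refining ₅C): if a later NODE-00 stage identifies, for every family `F`, admissible `θ`
and run `P`, the residual B13 group with the record of a two-scale torus step `Wt F θ P : TwoTorusStep 4 (L F θ P) (N′ F θ P)` and constants
`c F θ P` (`hS`, `hc`), and the torus leaf triple holds there (`hleaf` — `B13NodeTorusTermwise.b13Leaf_twoTorus_termwise ∕ _primitives`, or per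
step the located family `B13NodeTorusFamilyLocated.b13Family_located`), then `S_N10 Rec`. [cite: Balaban1988RG2Cluster, Lemmas 1–3 pp.9, 11, 20] -/
theorem s_N10_of_refines₅C_twoTorus (Rec : RecordPred N)
    (href : ∀ (F : T4Family) (D : Datum F N) (w : WorldP), Rec F D w → IsRecordOfRecord₅C F N D w)
    (L N' : (F : T4Family) → Stage5Params F N → B12.RunParams → ℕ)
    [∀ F θ P, NeZero (L F θ P)] [∀ F θ P, NeZero (N' F θ P)]
    (Wt : (F : T4Family) → (θ : Stage5Params F N) → (P : B12.RunParams) → TwoTorusStep 4 (L F θ P) (N' F θ P))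
    (c : (F : T4Family) → Stage5Params F N → B12.RunParams → B13.Consts)
    (hS : ∀ (F : T4Family) (θ : Stage5Params F N), θ.Admissible → ∀ P, (θ.res.X P).S13 = (Wt F θ P).toStepData)
    (hc : ∀ (F : T4Family) (θ : Stage5Params F N), θ.Admissible → ∀ P, (θ.res.X P).c13 = c F θ P)
    (hleaf : ∀ (F : T4Family) (θ : Stage5Params F N), θ.Admissible → ∀ P,
      B13.Lemma1Printed (Wt F θ P).toStepData (c F θ P) ∧ B13.Lemma2Printed (Wt F θ P).toStepData (c F θ P) ∧
        B13.Lemma3Printed (Wt F θ P).toStepData (c F θ P)) :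
    S_N10 Rec :=
  fun F D w hR P =>
    b13_main_forall_isRecordOfRecord₅C_twoTorus (L F) (N' F) (Wt F) (c F) (hS F) (hc F) (hleaf F) D w (href F D w hR) P

/-- Bookkeeping: `S_N10 Rec` is the N10 conjunct the cluster join `FlowBounds_of` consumes (third argument), so the two theorems above ARE the
K2-facing N10 closers modulo the slot. [cite: Balaban1988RG2Cluster, Lemmas 1–3 pp.9, 11, 20 (bookkeeping)] -/
theorem flowBounds_of_N10 (Rec : RecordPred N) (h3 : S_N03 Rec) (h6 : S_N06 Rec) (h10 : S_N10 Rec) (h9 : S_N09 Rec) (h11 : S_N11 Rec)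
    (h13 : S_N13 Rec) : FlowBounds Rec :=
  FlowBounds_of Rec h3 h6 h10 h9 h11 h13

/-! ## §2 (v2, 2026-08-26 — the CLOSERS-OF-RECORD SHAPE, plan word (W2) [YMPLAN-G62-WORD-MODULES + W2]) the stub unfolded (`Iff.rfl`); antitone in
`Rec`; from the leaf; the REFINEMENT-GENERIC closer over the N-binding Stage-5 record `IsRecordOfRecord₅`; the K2 cluster minus N10.  VACUITY GUARDS
(A5) for N10 are NOT available at any landed stage and none is claimed: the in-edges `b9` ([13]) ∕ `b11` ([15]) ∕ `b12` ([I] Lemma 4) read RESIDUAL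
carriers too (`B13NodeKnitRecord5C.inEdges_iff_res₅C`), so at Stages 5–8 neither the in-edges nor the leaf `b13` are theorems — the slot (B13₅)
stays displayed until Stage 4(X.B13) pins the group (STAGE5-SCOPING-g28 (P2)). -/

/-- **What `S_N10 Rec` says** (`Iff.rfl`): at every run of every binding world of every record pair, the in-edge leaves `b9` ([13] =
[Balaban1985BackgroundPropagators]), `b10` ([16]), `b11` ([15]), `b12` ([I] §§2–5) imply N10's leaf `b13` ([Balaban1988RG2Cluster] Lemmas 1–3 as bound by
the world's upstream block). [cite: Balaban1988RG2Cluster, Lemmas 1–3 pp.9, 11, 20; p.1 (in-edges; bookkeeping)] -/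
theorem s_N10_iff (Rec : RecordPred N) :
    S_N10 Rec ↔ ∀ (F : T4Family) (D : Datum F N) (w : WorldP), Rec F D w → ∀ P : B12.RunParams,
      (leavesP w P).b9 → (leavesP w P).b10 → (leavesP w P).b11 → (leavesP w P).b12 → (leavesP w P).b13 :=
  Iff.rfl

/-- **`S_N10` is ANTITONE in the record predicate**: proved at `Rec`, it holds at every `Rec'` refining `Rec` — every later NODE 00 stage (₇C, ₈C, the
₉C re-base once `isRecordOfRecord₅C_of_isRecordOfRecord₉C` lands) and the route's re-letterings inherit it by one application.
[cite: Balaban1988RG2Cluster, Lemmas 1–3 pp.9, 11, 20 (bookkeeping)] -/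
theorem s_N10_antitone {Rec Rec' : RecordPred N}
    (hle : ∀ (F : T4Family) (D : Datum F N) (w : WorldP), Rec' F D w → Rec F D w) (h : S_N10 Rec) : S_N10 Rec' :=
  fun F D w hR P => h F D w (hle F D w hR) P

/-- `S_N10 Rec` from N10's OWN LEAF `b13` at the record (the in-edges are not consumed — how every torus knit of the lineage concludes:
`B13NodeTorusTermwise.b13_main_of_leaf_twoTorus`, `B13NodeKnitRecord5C.b13_main_of_b13`; no ex-falso route through `b9`–`b12`).
[cite: Balaban1988RG2Cluster, Lemmas 1–3 pp.9, 11, 20 (bookkeeping)] -/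
theorem s_N10_of_leaf_b13 (Rec : RecordPred N)
    (h : ∀ (F : T4Family) (D : Datum F N) (w : WorldP), Rec F D w → ∀ P : B12.RunParams, (leavesP w P).b13) : S_N10 Rec :=
  fun F D w hR P _ _ _ _ => h F D w hR P

/-- **REFINEMENT-GENERIC CLOSER, N-binding** (the literal twin of `s_N10_of_refines₅C`): `S_N10 Rec` for EVERY record predicate refining NODE 00's
Stage-5 record predicate `IsRecordOfRecord₅` (N-binding; [16] Thm 1 read LITERALLY in the slot), from the slot (B13₅) via
`B13NodeKnitRecord5C.b13_main_forall_isRecordOfRecord₅`. [cite: Balaban1988RG2Cluster, Lemmas 1–3 pp.9, 11, 20] -/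
theorem s_N10_of_refines₅ (Rec : RecordPred N)
    (href : ∀ (F : T4Family) (D : Datum F N) (w : WorldP), Rec F D w → Node00.IsRecordOfRecord₅ F N D w)
    (slots : ∀ (F : T4Family) (θ : Stage5Params F N), θ.Admissible → ∀ P : B12.RunParams,
      B9LeafX (θ.res.Y P) → (B10.Thm1Printed (θ.res.X P).runs10 ∧ B10.Thm2Printed (θ.res.X P).runs10) →
        B11Leaf (θ.res.Z P) → B12Sec2to5.Lemma4Printed (θ.res.X P).F12 (θ.res.X P).c12 →
          B13.Lemma1Printed (θ.res.X P).S13 (θ.res.X P).c13 ∧ B13.Lemma2Printed (θ.res.X P).S13 (θ.res.X P).c13 ∧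
            B13.Lemma3Printed (θ.res.X P).S13 (θ.res.X P).c13) :
    S_N10 Rec :=
  fun F D w hR P => B13NodeKnitRecord5C.b13_main_forall_isRecordOfRecord₅ (slots F) D w (href F D w hR) P

/-- **THE K2 CLUSTER MINUS N10**: given `S_N10 Rec`, `FlowBounds Rec` is exactly the conjunction of the other five K2 stubs `S_N03 · S_N06 · S_N09 ·
S_N11 · S_N13` (the cluster statement is `AtRecord Rec (B6 ∧ B9 ∧ B13 ∧ B12 ∧ B14 ∧ B16)`). [cite: Balaban1988RG2Cluster, Lemmas 1–3 pp.9, 11, 20 (bookkeeping)] -/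
theorem flowBounds_iff_of_s_N10 (Rec : RecordPred N) (h10 : S_N10 Rec) :
    FlowBounds Rec ↔ S_N03 Rec ∧ S_N06 Rec ∧ S_N09 Rec ∧ S_N11 Rec ∧ S_N13 Rec := by
  refine ⟨fun h => ⟨fun F D w hR P => (h F D w hR P).1, fun F D w hR P => (h F D w hR P).2.1,
    fun F D w hR P => (h F D w hR P).2.2.2.1, fun F D w hR P => (h F D w hR P).2.2.2.2.1,
    fun F D w hR P => (h F D w hR P).2.2.2.2.2⟩, fun ⟨h3, h6, h9, h11, h13⟩ => ?_⟩
  exact FlowBounds_of Rec h3 h6 h10 h9 h11 h13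

end Summit.QuantumFields.YangMills.BalabanUVNodes.N10AtRecord

end
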